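import Mathlib

/-!
# `Φ₀` for two petals: the H-side lemma and the same-sign half of the charging inequality

Setting of `…SunflowerPhiZeroPair` (normalised two-petal (RES0′) model; masses `c, ε_Y, ε_g, ε_h ≥ 0`, `c + ε_Y + ε_g + ε_h = 1`;
petal `j`: Ȳ-usage `x_j`, g-excess `ζ_j = z_j − 1 ≥ 0`, h-excess `ρ_j = r_j − 1 ≥ 0`, link `g ≤ h` in the form `κ(1+ζ_j) ≤ 1+ρ_j`).
Write `b_j = ε_gζ_j + ε_hρ_j` (H-excess), `s_j = (1−ε_Y)(x_j−1) − b_j` (signed Ȳ-cover surplus), `M = (r₁r₂/κ − z₁z₂)₊` and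
`stuff = ε_gζ₁ζ₂ + ε_hρ₁ρ₂ + ε_g M`.  Then (prove-1 g54 memo §7(g)(ix))
`(1−ε_Y)(pay − cross) = ε_Y s₁s₂ + (1−ε_Y)·stuff − b₁b₂`  (exact), and

* `hside_stuff` — **H-side lemma**: `b₁b₂ ≤ (ε_g+ε_h)·stuff` for all petals obeying the links (the leverage pot pays the
  g×h mismatch `ε_gε_h(ζ₁−ρ₁)(ρ₂−ζ₂)` of oppositely shaped petals; proportional shapes need no pot);
* `charging_of_same_sign` — hence `cross ≤ pay` whenever `s₁s₂ ≥ 0`, i.e. for two k-covered petals (`s_j ≥ 0`: hubs, dwarfs,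
  x-petals) and for two h-rich petals (`s_j ≤ 0`), with NO cap/tying hypothesis at all; feeding it to
  `pair_le_phi0G_of_charging` (file `…SunflowerPhiZeroPair`) gives `V₁V₂ ≤ Φ₀ᴳ ≤ Φ₀` for all such pairs.
  The mixed-sign case (one h-rich, one k-covered petal) is where the tying `ε_h a ≤ θε_g/κ, θ ≤ c` is needed
  (`charging_hpetal` is its extreme instance).  [this work]
-/

namespace Summit.CriticalPhenomena.PercolationContinuityZ3.Theorems.SunflowerPartition.SafeCalc.LinkedCurrency

/-- The pot dominates the shape mismatch: `(ζ₁−ρ₁)(ζ₂−ρ₂) + M ≥ 0` whenever `M ≥ (1+ρ₁)(1+ρ₂)/κ − (1+ζ₁)(1+ζ₂)`, `M ≥ 0`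
and the links `κ(1+ζ_j) ≤ 1+ρ_j` hold (`κ > 0`, `ρ_j ≥ 0`). [this work] -/
theorem mismatch_le_pot {κ ζ₁ ζ₂ ρ₁ ρ₂ M : ℝ} (hκ : 0 < κ) (hρ1 : 0 ≤ ρ₁) (hρ2 : 0 ≤ ρ₂) (hl1 : κ * (1 + ζ₁) ≤ 1 + ρ₁) (hl2 : κ * (1 + ζ₂) ≤ 1 + ρ₂)
    (hM : (1 + ρ₁) * (1 + ρ₂) / κ - (1 + ζ₁) * (1 + ζ₂) ≤ M) (hM0 : 0 ≤ M) :
    0 ≤ (ζ₁ - ρ₁) * (ζ₂ - ρ₂) + M := by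
  have hz1 : 1 + ζ₁ ≤ (1 + ρ₁) / κ := by rw [le_div_iff₀ hκ]; linarith
  have hz2 : 1 + ζ₂ ≤ (1 + ρ₂) / κ := by rw [le_div_iff₀ hκ]; linarith
  -- M ≥ (1+ζ₁)(ρ₂−ζ₂) and M ≥ (1+ζ₂)(ρ₁−ζ₁)
  have hM1 : (1 + ζ₁) * (ρ₂ - ζ₂) ≤ M := by
    have e : (1 + ρ₁) / κ * (1 + ρ₂) = (1 + ρ₁) * (1 + ρ₂) / κ := by ring
    have : (1 + ζ₁) * (1 + ρ₂) ≤ (1 + ρ₁) * (1 + ρ₂) / κ := by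
      have := mul_le_mul_of_nonneg_right hz1 (by linarith : (0:ℝ) ≤ 1 + ρ₂)
      rwa [e] at this
    nlinarith
  have hM2 : (1 + ζ₂) * (ρ₁ - ζ₁) ≤ M := by
    have e : (1 + ρ₁) * ((1 + ρ₂) / κ) = (1 + ρ₁) * (1 + ρ₂) / κ := by ring
    have : (1 + ρ₁) * (1 + ζ₂) ≤ (1 + ρ₁) * (1 + ρ₂) / κ := by
      have := mul_le_mul_of_nonneg_left hz2 (by linarith : (0:ℝ) ≤ 1 + ρ₁)
      rwa [e] at this
    nlinarith
  rcases le_total ζ₁ ρ₁ with h1 | h1 <;> rcases le_total ζ₂ ρ₂ with h2 | h2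
  · nlinarith [mul_nonneg (sub_nonneg.2 h1) (sub_nonneg.2 h2)]
  · -- ζ₁ ≤ ρ₁, ρ₂ ≤ ζ₂ : use hM2
    nlinarith [mul_nonneg (sub_nonneg.2 h1) (sub_nonneg.2 h2), mul_nonneg hρ2 (sub_nonneg.2 h1)]
  · -- ρ₁ ≤ ζ₁, ζ₂ ≤ ρ₂ : use hM1
    nlinarith [mul_nonneg (sub_nonneg.2 h1) (sub_nonneg.2 h2), mul_nonneg hρ1 (sub_nonneg.2 h2)]
  · nlinarith [mul_nonneg (sub_nonneg.2 h1) (sub_nonneg.2 h2)]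

/-- **H-side lemma.**  `(ε_gζ₁ + ε_hρ₁)(ε_gζ₂ + ε_hρ₂) ≤ (ε_g + ε_h)(ε_gζ₁ζ₂ + ε_hρ₁ρ₂ + ε_g M)` for `ε_g, ε_h ≥ 0`,
excesses `≥ 0`, links `κ(1+ζ_j) ≤ 1+ρ_j` and any `M ≥ max((1+ρ₁)(1+ρ₂)/κ − (1+ζ₁)(1+ζ₂), 0)` (`ε_h ≤ 1` not needed):
the identity `(ε_g+ε_h)(ε_gζ₁ζ₂ + ε_hρ₁ρ₂) − b₁b₂ = ε_gε_h(ζ₁−ρ₁)(ζ₂−ρ₂)` plus `mismatch_le_pot`. [this work] -/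
theorem hside_stuff {εg εh κ ζ₁ ζ₂ ρ₁ ρ₂ M : ℝ} (hεg : 0 ≤ εg) (hεh : 0 ≤ εh) (hκ : 0 < κ)
    (hρ1 : 0 ≤ ρ₁) (hρ2 : 0 ≤ ρ₂)
    (hl1 : κ * (1 + ζ₁) ≤ 1 + ρ₁) (hl2 : κ * (1 + ζ₂) ≤ 1 + ρ₂)
    (hM : (1 + ρ₁) * (1 + ρ₂) / κ - (1 + ζ₁) * (1 + ζ₂) ≤ M) (hM0 : 0 ≤ M) :
    (εg * ζ₁ + εh * ρ₁) * (εg * ζ₂ + εh * ρ₂) ≤ (εg + εh) * (εg * (ζ₁ * ζ₂) + εh * (ρ₁ * ρ₂) + εg * M) := by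
  have hmm := mismatch_le_pot hκ hρ1 hρ2 hl1 hl2 hM hM0
  have key : (εg + εh) * (εg * (ζ₁ * ζ₂) + εh * (ρ₁ * ρ₂) + εg * M) - (εg * ζ₁ + εh * ρ₁) * (εg * ζ₂ + εh * ρ₂) =
      εg * εh * ((ζ₁ - ρ₁) * (ζ₂ - ρ₂) + M) + εg * εg * M + εg * (1 - εh) * 0 := by ring
  have h1 : 0 ≤ εg * εh * ((ζ₁ - ρ₁) * (ζ₂ - ρ₂) + M) := mul_nonneg (mul_nonneg hεg hεh) hmm
  have h2 : 0 ≤ εg * εg * M := mul_nonneg (mul_nonneg hεg hεg) hM0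
  nlinarith

/-- **Charging inequality, same-sign half.**  In the two-petal setting (`ε_Y < 1`, `ε_g, ε_h ≥ 0`, `ε_Y + ε_g + ε_h ≤ 1`,
`κ > 0`, `z_j, r_j ≥ 1`, links `κ z_j ≤ r_j`), if the signed Ȳ-cover surpluses
`s_j = (1−ε_Y)(x_j−1) − ε_g(z_j−1) − ε_h(r_j−1)` have the same sign (`s₁s₂ ≥ 0`), then `cross ≤ pay`
(the hypothesis `hcharge` of `pair_le_phi0G_of_charging`).  Proof: `(1−ε_Y)(pay−cross) = ε_Y s₁s₂ + (1−ε_Y)stuff − b₁b₂`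
and `(1−ε_Y)stuff ≥ (ε_g+ε_h)stuff ≥ b₁b₂` (`hside_stuff`). [this work] -/
theorem charging_of_same_sign {εY εg εh κ x₁ x₂ z₁ z₂ r₁ r₂ : ℝ}
    (hY0 : 0 ≤ εY) (hY1 : εY < 1) (hεg : 0 ≤ εg) (hεh : 0 ≤ εh) (hsum : εY + εg + εh ≤ 1) (hκ : 0 < κ)
    (hz1 : 1 ≤ z₁) (hz2 : 1 ≤ z₂) (hr1 : 1 ≤ r₁) (hr2 : 1 ≤ r₂) (hl1 : κ * z₁ ≤ r₁) (hl2 : κ * z₂ ≤ r₂)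
    (hss : 0 ≤ ((1 - εY) * (x₁ - 1) - εg * (z₁ - 1) - εh * (r₁ - 1)) *
        ((1 - εY) * (x₂ - 1) - εg * (z₂ - 1) - εh * (r₂ - 1))) :
    εg * εY * ((x₁ - 1) * (z₂ - 1) + (x₂ - 1) * (z₁ - 1)) +
        εh * εY * ((x₁ - 1) * (r₂ - 1) + (x₂ - 1) * (r₁ - 1)) +
        εg * εh * ((z₁ - 1) * (r₂ - 1) + (z₂ - 1) * (r₁ - 1)) ≤
      εY * (1 - εY) * ((x₁ - 1) * (x₂ - 1)) + εh * (1 - εh) * ((r₁ - 1) * (r₂ - 1)) +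
        εg * (1 - εg) * ((z₁ - 1) * (z₂ - 1)) + εg * max (r₁ * r₂ / κ - z₁ * z₂) 0 := by
  set M := max (r₁ * r₂ / κ - z₁ * z₂) 0 with hMdef
  have hM0 : 0 ≤ M := le_max_right _ _
  have hM : (1 + (r₁ - 1)) * (1 + (r₂ - 1)) / κ - (1 + (z₁ - 1)) * (1 + (z₂ - 1)) ≤ M := by
    have := le_max_left (r₁ * r₂ / κ - z₁ * z₂) 0
    simp only [add_sub_cancel] ; exact this
  have hs := hside_stuff (ζ₁ := z₁ - 1) (ζ₂ := z₂ - 1) (ρ₁ := r₁ - 1) (ρ₂ := r₂ - 1) hεg hεh hκ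
    (by linarith) (by linarith) (by linarith) (by linarith) hM hM0
  -- (1−ε_Y)(pay − cross) = ε_Y s₁ s₂ + [(1−ε_Y) stuff − b₁ b₂]
  have key : (1 - εY) * ((εY * (1 - εY) * ((x₁ - 1) * (x₂ - 1)) + εh * (1 - εh) * ((r₁ - 1) * (r₂ - 1)) +
        εg * (1 - εg) * ((z₁ - 1) * (z₂ - 1)) + εg * M) -
      (εg * εY * ((x₁ - 1) * (z₂ - 1) + (x₂ - 1) * (z₁ - 1)) +
        εh * εY * ((x₁ - 1) * (r₂ - 1) + (x₂ - 1) * (r₁ - 1)) +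
        εg * εh * ((z₁ - 1) * (r₂ - 1) + (z₂ - 1) * (r₁ - 1)))) =
      εY * (((1 - εY) * (x₁ - 1) - εg * (z₁ - 1) - εh * (r₁ - 1)) *
        ((1 - εY) * (x₂ - 1) - εg * (z₂ - 1) - εh * (r₂ - 1))) +
      ((1 - εY) * (εg * ((z₁ - 1) * (z₂ - 1)) + εh * ((r₁ - 1) * (r₂ - 1)) + εg * M) -
        (εg * (z₁ - 1) + εh * (r₁ - 1)) * (εg * (z₂ - 1) + εh * (r₂ - 1))) := by ring
  have hstuff0 : 0 ≤ εg * ((z₁ - 1) * (z₂ - 1)) + εh * ((r₁ - 1) * (r₂ - 1)) + εg * M :=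
    add_nonneg (add_nonneg (mul_nonneg hεg (mul_nonneg (by linarith) (by linarith)))
      (mul_nonneg hεh (mul_nonneg (by linarith) (by linarith)))) (mul_nonneg hεg hM0)
  have hc : εg + εh ≤ 1 - εY := by linarith
  have h2 : (εg * (z₁ - 1) + εh * (r₁ - 1)) * (εg * (z₂ - 1) + εh * (r₂ - 1)) ≤
      (1 - εY) * (εg * ((z₁ - 1) * (z₂ - 1)) + εh * ((r₁ - 1) * (r₂ - 1)) + εg * M) :=
    hs.trans (mul_le_mul_of_nonneg_right hc hstuff0)
  have h1 : 0 ≤ εY * (((1 - εY) * (x₁ - 1) - εg * (z₁ - 1) - εh * (r₁ - 1)) *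
        ((1 - εY) * (x₂ - 1) - εg * (z₂ - 1) - εh * (r₂ - 1))) := mul_nonneg hY0 hss
  have hpos : 0 < 1 - εY := by linarith
  have hD : 0 ≤ (εY * (1 - εY) * ((x₁ - 1) * (x₂ - 1)) + εh * (1 - εh) * ((r₁ - 1) * (r₂ - 1)) +
        εg * (1 - εg) * ((z₁ - 1) * (z₂ - 1)) + εg * M) -
      (εg * εY * ((x₁ - 1) * (z₂ - 1) + (x₂ - 1) * (z₁ - 1)) +
        εh * εY * ((x₁ - 1) * (r₂ - 1) + (x₂ - 1) * (r₁ - 1)) +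
        εg * εh * ((z₁ - 1) * (r₂ - 1) + (z₂ - 1) * (r₁ - 1))) := by
    rw [← mul_nonneg_iff_of_pos_left hpos, key]
    linarith
  linarith

end Summit.CriticalPhenomena.PercolationContinuityZ3.Theorems.SunflowerPartition.SafeCalc.LinkedCurrency
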